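import Literature.AnabelianGeometry.AbsoluteAnabelian.AbsCuspCohomology
import Literature.AnabelianGeometry.AbsoluteAnabelian.AbsCuspFactsSchemaRefutations
import Literature.AnabelianGeometry.AbsoluteAnabelian.AbsTopIII.CuspidalCyclotomeKummerUnitsClosureRefutations
import Literature.AnabelianGeometry.AbsoluteAnabelian.MLFGaloisTypeProofs
import Literature.Algebra.Homology.ContCohomologyCrossedHomPrincipal
import HarnessLib

/-!
# [AbsCusp] Prop. 2.1 (ii) (`Prop_2_1_ii_ker`, `Prop_2_1_ii_model`): the universal closures of the
# FACT-LIST rows F-0042 / F-0043 are REFUTED by a junk presentation with central cuspidal kernel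

S. Mochizuki, *Absolute anabelian cuspidalizations of proper hyperbolic curves*, J. Math. Kyoto Univ.
**47** (2007), Prop. 2.1 (ii) p. 36 (`paper:doi-10-1215-kjm-1250281022`): "restricting cohomology
classes of `Π_{U_S}` to the various `I_x[U_S]`, for `x ∈ S`, yields a natural exact sequence
`1 → (k^×)^∧ → H¹(Π_{U_S}, M_X) → ⊕_{x∈S} Ẑ†`" [cite: MochizukiAbsCusp2007, Prop 2.1 (ii) p.36].
Typed by abc-iut-L4-t16 (`AbsCuspCohomology.lean`) as the SCHEMA `AbsCusp.Prop_2_1_ii_ker r q I`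
("`c|_{I_x} = 0 ∀ x ↔ c|_{Δ_{U_S}} = 0`", over an ARBITRARY presentation `r, q` and family `I`) and
its (M)-form `AbsCusp.Prop_2_1_ii_model M` over the INTERFACE `CurveModel` (a record of free data;
"nothing here asserts that a model exists", `CurveModel.lean`).

PROOF-ONLY companion (cell abc-iut, seat abc-iut-f-054, F fact-proving wave, FROZEN FACT-LIST rows
**F-0042**, **F-0043**; no definitions; the declaring file and the junk extension of seat f-078's
`CuspidalCyclotomeKummerUnitsClosureRefutations.lean` are imported, never edited).  The companion
`AbsCuspCohomologyKerProofs.lean` PROVES the half "(⇐)" of the schema for all data and reduces both rows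
to the converse half "(⇒)" ("a class unramified at every cusp of `U_S` dies on `Δ_{U_S}`", in print a
weight argument over an MLF).  Here that converse half is shown NOT to follow from the abstract data:

* `cuspidallyCentralModulus_eq_bot_of_central`, `geomCyclotomeRep_apply_of_central` — if the cuspidal
  kernel `N = Ker(Π_{U_x} → Π_X) ∩ Δ` is CENTRAL in `Π_{U_x}`, then `[N, Δ]⁻ = 1`, `M_X = N`, and ALL of
  `Π_{U_S}` acts trivially on `M_X`;
* `not_prop_2_1_ii_ker_of_central` — so every continuous homomorphism `φ : Π_{U_S} → N` is a crossed
  homomorphism, and if `φ(d) ≠ 1` for some `d ∈ Δ_{U_S}` its class restricts NON-trivially to `Δ_{U_S}`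
  (Literature `ContinuousCohomology.eq_zero_of_crossedHomClass_eq_zero`: for a trivial action a class
  vanishes only if the homomorphism does) while it restricts to `0` on a family `I` on which all
  classes die (e.g. `S = ∅`): `Prop_2_1_ii_ker r q I` FAILS;
* `not_forall_prop_2_1_ii_ker` (**F-0042**) — at seat f-078's junk extension `Π = G_{ℚ_2} × Ẑ ↠ G_{ℚ_2}`
  with cuspidal quotient `(γ, z) ↦ (γ, 1)` (`N = Δ = Ẑ`, central), `φ = (γ, z) ↦ (1, z)`, `S = ∅`:
  the universal closure over `(E', E, F, r, q, S, I)` (universe `0`) is FALSE;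
* `not_forall_prop_2_1_ii_model` (**F-0043**) — the same presentation packaged as a two-curve
  `CurveModel` over the MLF `ℚ_2` (`U_x = X` carrying f-078's rational cusp with `I_x = Δ ≅ Ẑ`, a
  cyclotome presentation; `U_S` the same extension declared CUSPLESS): the universal closure over
  `M : CurveModel.{0}` is FALSE.

Consequence for bookkeeping only (plan rule R5): F-0042 / F-0043 are SCHEMAS, consumable at the genuine
étale-`π₁` instance (not constructible in the tree) and never as closed facts; the PROVED instance content
is in `AbsCuspCohomologyKerProofs.lean`.  HONEST FRAMING: the junk presentation is not a hyperbolic curve;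
nothing here bears on the printed Prop. 2.1 (ii) (refereed, undisputed) or on [IUTchIII] Cor. 3.12;
refuting a universal closure ≠ refuting print; typed ≠ proved.
-/

noncomputable section

open CategoryTheory Topology
open scoped Pointwise

namespace Literature.AnabelianGeometry.AbsoluteAnabelian

namespace AbsCusp

open AbsTopIII ContinuousCohomology

universe u

section Central

variable {E' E F : FundamentalExtension.{u}} (r : E' ⟶ E) (q : E ⟶ F)

/-! ### Presentations with CENTRAL cuspidal kernel: `[N, Δ]⁻ = 1` and the action on `M_X` is trivial -/

/-- If `N = Ker(Π_{U_x} → Π_X) ∩ Δ_{U_x}` is central in `Π_{U_x}`, the cuspidally central modulus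
`[N, Δ_{U_x}]⁻` is trivial. [cite: MochizukiAbsCusp2007, Def 1.1 (i) p.10] -/
theorem cuspidallyCentralModulus_eq_bot_of_central
    (hN : ∀ n ∈ cuspidalKernel q, ∀ g : E.arith, g * n = n * g) :
    AbsTopIII.cuspidallyCentralModulus q = ⊥ := by
  have hcomm : ⁅cuspidalKernel q, E.geom⁆ = ⊥ := by
    rw [Subgroup.commutator_eq_bot_iff_le_centralizer]
    intro n hn
    rw [Subgroup.mem_centralizer_iff]
    intro g _
    exact hN n hn g
  rw [AbsTopIII.cuspidallyCentralModulus, hcomm]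
  exact topologicalClosure_bot

/-- With `N` central, conjugation by ANY element of `Π_{U_x}/[N, Δ]⁻` is trivial on `M_X` (the image
of `N`). [cite: MochizukiAbsCusp2007, Prop 2.1 (i) p.35] -/
theorem conjNormal_mk_eq_of_central (hN : ∀ n ∈ cuspidalKernel q, ∀ g : E.arith, g * n = n * g)
    (c : E.arith) (w : geomCyclotome q) :
    MulAut.conjNormal (QuotientGroup.mk' (AbsTopIII.cuspidallyCentralModulus q) c :
      CuspidallyCentralQuotient q) w = w := by
  obtain ⟨y, hy⟩ := w
  obtain ⟨x, hx, rfl⟩ := Subgroup.mem_map.mp hy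
  apply Subtype.ext
  rw [MulAut.conjNormal_apply]
  change QuotientGroup.mk' _ c * QuotientGroup.mk' _ x * (QuotientGroup.mk' _ c)⁻¹ =
    QuotientGroup.mk' _ x
  rw [← map_inv, ← map_mul, ← map_mul, hN x hx c, mul_inv_cancel_right]

/-- **With `N` central, all of `Π_{U_S}` acts trivially on `M_X`** (for any `r : Π_{U_S} → Π_{U_x}`).
[cite: MochizukiAbsCusp2007, Prop 2.1 (i) p.35] -/
theorem geomCyclotomeRep_apply_of_central
    (hN : ∀ n ∈ cuspidalKernel q, ∀ g : E.arith, g * n = n * g) (a : E'.arith)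
    (v : Additive (geomCyclotome q)) : geomCyclotomeRep r q a v = v := by
  change conjCLM (geomCyclotome q) (toCuspidallyCentralQuotient r q a) v = v
  rw [conjCLM_apply]
  change Additive.ofMul (MulAut.conjNormal
    (QuotientGroup.mk' (AbsTopIII.cuspidallyCentralModulus q) (r.arith a)) (Additive.toMul v)) = v
  rw [conjNormal_mk_eq_of_central q hN]
  rfl

/-! ### The class of a homomorphism `Π_{U_S} → N` and its restriction to `Δ_{U_S}` -/

/-- **Core of the refutations.**  Let the cuspidal kernel `N` of `q : Π_{U_x} → Π_X` be central, let
`φ : Π_{U_S} → Π_{U_x}` be a continuous homomorphism with values in `N` and `d ∈ Δ_{U_S}` with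
`φ d ≠ 1`, and let `I` be a family of subgroups on which every class of `H¹(Π_{U_S}, M_X)` dies (e.g.
the empty family).  Then `Prop_2_1_ii_ker r q I` is FALSE: the class of the crossed homomorphism
`a ↦ [φ a] ∈ M_X` dies on every `I_x` but not on `Δ_{U_S}` — for the (trivial) action its restriction
to `Δ_{U_S}` has class `0` only if it vanishes (`ContinuousCohomology.eq_zero_of_crossedHomClass_eq_zero`),
and its value at `d` is `[φ d] ≠ 0` because `[N, Δ]⁻ = 1`. [cite: MochizukiAbsCusp2007, Prop 2.1 (ii) p.36] -/
theorem not_prop_2_1_ii_ker_of_central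
    (hN : ∀ n ∈ cuspidalKernel q, ∀ g : E.arith, g * n = n * g)
    (φ : E'.arith →ₜ* E.arith) (hφ : ∀ a, φ a ∈ cuspidalKernel q)
    {d : E'.arith} (hd : d ∈ E'.geom) (hφd : φ d ≠ 1)
    {S : Type u} (I : S → Subgroup E'.arith)
    (hvac : ∀ (c : geomCyclotomeH1 r q) (x : S), geomCyclotomeH1Res r q (I x) c = 0) :
    ¬ Literature.AnabelianGeometry.AbsoluteAnabelian.AbsCusp.Prop_2_1_ii_ker r q I := by
  intro h
  -- the continuous crossed homomorphism `a ↦ [φ a]`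
  let f : C(E'.arith, Additive (geomCyclotome q)) :=
    ⟨fun a => Additive.ofMul
        (⟨QuotientGroup.mk' (AbsTopIII.cuspidallyCentralModulus q) (φ a),
          Subgroup.mem_map_of_mem _ (hφ a)⟩ : geomCyclotome q),
      continuous_ofMul.comp ((QuotientGroup.continuous_mk.comp φ.continuous).subtype_mk _)⟩
  have hf : ∀ a b : E'.arith, f (a * b) = f a + (geomCyclotomeTopRep r q).ρ a (f b) := by
    intro a b
    have htriv : (geomCyclotomeTopRep r q).ρ a (f b) = f b :=
      geomCyclotomeRep_apply_of_central r q hN a (f b)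
    rw [htriv]
    change Additive.ofMul _ = Additive.ofMul _ + Additive.ofMul _
    rw [← ofMul_mul]
    congr 1
    apply Subtype.ext
    change QuotientGroup.mk' _ (φ (a * b)) = QuotientGroup.mk' _ (φ a) * QuotientGroup.mk' _ (φ b)
    rw [map_mul, map_mul]
  -- its class dies on every `I_x`, hence (by the schema) on `Δ_{U_S}`
  have hres : geomCyclotomeH1Res r q E'.geom (crossedHomClass.{0, u, u} (geomCyclotomeTopRep r q) f hf) = 0 :=
    (h _).mp (hvac _)
  -- restriction = class of the restricted crossed homomorphism
  have key := map_crossedHomClass.{0, u, u} (subgroupInclusion E'.geom)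
    (𝟙 (TopRep.res (subgroupInclusion E'.geom : E'.geom →* E'.arith) (geomCyclotomeTopRep r q))) f hf
  have hres' := key.symm.trans hres
  -- the restricted action is trivial, so the restricted crossed homomorphism vanishes
  have htriv : ∀ (g : E'.geom)
      (x : TopRep.res (subgroupInclusion E'.geom : E'.geom →* E'.arith) (geomCyclotomeTopRep r q)),
      (TopRep.res (subgroupInclusion E'.geom : E'.geom →* E'.arith) (geomCyclotomeTopRep r q)).ρ g x =
        x :=
    fun g x => geomCyclotomeRep_apply_of_central r q hN (g : E'.arith) x
  have hzero := eq_zero_of_crossedHomClass_eq_zero.{0, u, u} _ htriv _ _ hres'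
  -- evaluate at `d ∈ Δ_{U_S}`: `[φ d] = 1` in `Π_{U_x}/[N, Δ]⁻`, i.e. `φ d ∈ [N, Δ]⁻ = 1`
  have hd0 := congrArg (fun g => g ⟨d, hd⟩) hzero
  have h1 : (QuotientGroup.mk' (AbsTopIII.cuspidallyCentralModulus q) (φ d) :
      CuspidallyCentralQuotient q) = 1 :=
    congrArg (fun v : Additive (geomCyclotome q) =>
      ((Additive.toMul v : geomCyclotome q) : CuspidallyCentralQuotient q)) hd0
  rw [QuotientGroup.mk'_apply, QuotientGroup.eq_one_iff,
    cuspidallyCentralModulus_eq_bot_of_central q hN, Subgroup.mem_bot] at h1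
  exact hφd h1

end Central

/-! ### The junk presentation `Π = G_k × Ẑ ↠ G_k`, `(γ, z) ↦ (γ, 1)` (seat f-078) -/

section Junk

open KummerUnitsClosureWitness

variable (k : Type) [Field k] [CharZero k]

/-- The cuspidal kernel `N = Δ = 1 × Ẑ` of the junk quotient is central in `Π = G_k × Ẑ`.
[cite: MochizukiAbsTopIII2015, Prop 1.4 (ii) p.31] -/
theorem junk_central : ∀ n ∈ cuspidalKernel (resHom k), ∀ g : (ext k).arith, g * n = n * g := by
  intro n hn g
  rw [cuspidalKernel_resHom, mem_geom_iff] at hn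
  refine Prod.ext ?_ ?_
  · change g.1 * n.1 = n.1 * g.1
    rw [hn, mul_one, one_mul]
  · change g.2 * n.2 = n.2 * g.2
    exact mul_comm _ _

/-- The projection `φ : (γ, z) ↦ (1, z)` of `Π = G_k × Ẑ` onto `N = 1 × Ẑ` takes values in the cuspidal
kernel. [cite: MochizukiAbsTopIII2015, Prop 1.4 (ii) p.31] -/
theorem junk_proj_mem (a : (ext k).arith) :
    ((ContinuousMonoidHom.inr (Field.absoluteGaloisGroup k) Zhat).comp
        (ContinuousMonoidHom.snd (Field.absoluteGaloisGroup k) Zhat)) a ∈ cuspidalKernel (resHom k) := by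
  rw [cuspidalKernel_resHom]
  exact (mem_geom_iff k (((1 : Field.absoluteGaloisGroup k), a.2) : (ext k).arith)).mpr rfl

/-- `Ẑ ≠ 1`: the element `1 = (1)_p ∈ ∏_p ℤ_p` (written multiplicatively) is not the identity.
[cite: MochizukiAbsTopI2012, §0 p.7] -/
theorem ofAdd_one_ne_one_zhat :
    (Multiplicative.ofAdd (1 : ∀ p : Nat.Primes, @PadicInt (p : ℕ) ⟨p.2⟩) : Zhat) ≠ 1 := by
  intro h
  have h0 : (1 : ∀ p : Nat.Primes, @PadicInt (p : ℕ) ⟨p.2⟩) = 0 := Multiplicative.ofAdd.injective h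
  have h2 := congrFun h0 ⟨2, Nat.prime_two⟩
  exact one_ne_zero h2

/-- **The junk presentation violates the schema**: for the junk cuspidal quotient
`q : Π = G_k × Ẑ → Π`, `(γ, z) ↦ (γ, 1)` (cuspidal kernel `N = Δ = 1 × Ẑ`, central), ANY `r : Π → Π`
and ANY family `I` on which all classes die (e.g. no cusps), `Prop_2_1_ii_ker r q I` fails: the class
of `(γ, z) ↦ [(1, z)] ∈ M_X` is nonzero on `Δ = 1 × Ẑ` (at `d = (1, 1_Ẑ)`, `1_Ẑ = (1)_p ≠ 0`).
[cite: MochizukiAbsCusp2007, Prop 2.1 (ii) p.36] -/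
theorem not_prop_2_1_ii_ker_junk (r : ext k ⟶ ext k) {S : Type} (I : S → Subgroup (ext k).arith)
    (hvac : ∀ (c : geomCyclotomeH1 r (resHom k)) (x : S), geomCyclotomeH1Res r (resHom k) (I x) c = 0) :
    ¬ Literature.AnabelianGeometry.AbsoluteAnabelian.AbsCusp.Prop_2_1_ii_ker r (resHom k) I :=
  not_prop_2_1_ii_ker_of_central r (resHom k) (junk_central k)
    ((ContinuousMonoidHom.inr (Field.absoluteGaloisGroup k) Zhat).comp
      (ContinuousMonoidHom.snd (Field.absoluteGaloisGroup k) Zhat))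
    (junk_proj_mem k)
    (d := ((1 : Field.absoluteGaloisGroup k),
      (Multiplicative.ofAdd (1 : ∀ p : Nat.Primes, @PadicInt (p : ℕ) ⟨p.2⟩) : Zhat)))
    ((mem_geom_iff k _).mpr rfl)
    (fun h => ofAdd_one_ne_one_zhat (congrArg Prod.snd h))
    I hvac

end Junk

/-! ### F-0042: the universal closure of `Prop_2_1_ii_ker` is false -/

/-- **FACT-LIST row F-0042 is a schema, not a fact**: the universal closure of
`AbsCusp.Prop_2_1_ii_ker r q I` over all presentations `r : E' → E`, `q : E → F` and all families
`I : S → Subgroup Π_{E'}` (universe `0`) is FALSE — witness: seat f-078's junk extension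
`Π = G_{ℚ_2} × Ẑ ↠ G_{ℚ_2}` with `r = q =` the junk cuspidal quotient `(γ, z) ↦ (γ, 1)` and `S = ∅`
(`not_prop_2_1_ii_ker_junk`).  The row is consumable only at the étale-`π₁` instance; its half valid
for all data is `prop_2_1_ii_ker_mpr` (`AbsCuspCohomologyKerProofs.lean`).
[cite: MochizukiAbsCusp2007, Prop 2.1 (ii) p.36] -/
theorem not_forall_prop_2_1_ii_ker :
    ¬ ∀ (E' E F : FundamentalExtension.{0}) (r : E' ⟶ E) (q : E ⟶ F) (S : Type)
        (I : S → Subgroup E'.arith),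
        Literature.AnabelianGeometry.AbsoluteAnabelian.AbsCusp.Prop_2_1_ii_ker r q I :=
  fun h => not_prop_2_1_ii_ker_junk ℚ_[2] (KummerUnitsClosureWitness.resHom ℚ_[2])
    (fun x : PEmpty => x.elim) (fun _ x => x.elim) (h _ _ _ _ _ PEmpty _)

/-! ### F-0043: the universal closure of `Prop_2_1_ii_model` is false -/

/-- **FACT-LIST row F-0043 is a schema, not a fact**: the universal closure of
`AbsCusp.Prop_2_1_ii_model M` over the interface `M : CurveModel.{0}` is FALSE.  Witness: the two-curve
junk model over the MLF `ℚ_2` (`isMLF_padic`) — both curves carry seat f-078's extension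
`Π = G_{ℚ_2} × Ẑ ↠ G_{ℚ_2}`, all restriction maps are the junk quotient `(γ, z) ↦ (γ, 1)`; the curve
`U_x = X` carries ONE rational cusp with `D_x = Π`, `I_x = Δ ≅ Ẑ` (so `(U_x ⊆ X, x)` is a cyclotome
presentation, exactly as in `KummerUnitsClosureWitness.isCyclotomePresentation`), the curve `U_S` is
declared CUSPLESS.  All printed hypotheses of the (M)-form hold, and `Prop_2_1_ii_ker` fails there
(`not_prop_2_1_ii_ker_junk`).  The PROVED half for every model is `prop_2_1_ii_model_mpr`
(`AbsCuspCohomologyKerProofs.lean`). [cite: MochizukiAbsCusp2007, Prop 2.1 (ii) p.36] -/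
theorem not_forall_prop_2_1_ii_model :
    ¬ ∀ M : CurveModel.{0}, Literature.AnabelianGeometry.AbsoluteAnabelian.AbsCusp.Prop_2_1_ii_model M := by
  intro h
  -- no cusps on `U_S`
  let C₀ : (KummerUnitsClosureWitness.ext ℚ_[2]).CuspidalData :=
    { Cusp := PEmpty.{1}
      Dcusp := fun x => x.elim
      Icusp := fun x => x.elim
      Icusp_eq := fun x => x.elim
      isClosed_Dcusp := fun x => x.elim
      eq_of_conj := fun x => x.elim }
  -- the two-curve junk model: `true` = `U_x = X` (one cusp, `I_x = Δ`), `false` = `U_S` (cuspless)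
  let M : CurveModel.{0} :=
    { Curve := ULift.{1} Bool
      base := fun _ => ℚ_[2]
      ext := fun _ => KummerUnitsClosureWitness.ext ℚ_[2]
      galIso := fun _ => Iso.refl _
      cusps := fun b => match b with
        | ⟨true⟩ => KummerUnitsClosureWitness.cusps ℚ_[2]
        | ⟨false⟩ => C₀
      IsProper := fun _ => True
      IsScheme := fun _ => True
      genus := fun _ => 0
      FunctionField := fun _ => ℚ_[2]
      Point := fun _ => PEmpty.{1}
      decomp := fun _ x => x.elim
      IsNFCurve := fun _ => False
      IsNFPoint := fun _ x => x.elim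
      IsNFRational := fun _ _ => False
      IsNFConstant := fun _ _ => False
      NFFunctionField := fun _ => ℚ_[2]
      IsStrictlyBelyiType := fun _ => False
      IsCofiniteOpen := fun _ _ => True
      res := fun {U U'} _ => KummerUnitsClosureWitness.resHom ℚ_[2] }
  -- `(U_x ⊆ X, x)` is a cyclotome presentation (as in f-078's one-curve model)
  have hcyc : M.IsCyclotomePresentation (Ux := ULift.up true) (X := ULift.up true) trivial PUnit.unit :=
    { isScheme := ⟨trivial, trivial⟩
      isProper := trivial
      isRational := fun g _ => ⟨(g, 1), Subgroup.mem_top _, rfl⟩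
      isFreeProcyclic := KummerUnitsClosureWitness.isFreeProcyclic_geom ℚ_[2]
      kernel_eq := by
        change cuspidalKernel (KummerUnitsClosureWitness.resHom ℚ_[2]) =
          (Subgroup.normalClosure ((KummerUnitsClosureWitness.ext ℚ_[2]).geom :
            Set (KummerUnitsClosureWitness.ext ℚ_[2]).arith)).topologicalClosure
        rw [KummerUnitsClosureWitness.cuspidalKernel_resHom,
          KummerUnitsClosureWitness.topologicalClosure_normalClosure_geom]
      isCuspidallyCentral := by
        change IsCuspidallyCentralExtension (KummerUnitsClosureWitness.resHom ℚ_[2])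
          (KummerUnitsClosureWitness.ext ℚ_[2]).geom
        refine ⟨?_, ?_⟩
        · rw [KummerUnitsClosureWitness.cuspidallyCentralModulus_resHom, inf_bot_eq]
        · rw [KummerUnitsClosureWitness.cuspidallyCentralModulus_resHom,
            KummerUnitsClosureWitness.cuspidalKernel_resHom, sup_bot_eq] }
  have hP : Literature.AnabelianGeometry.AbsoluteAnabelian.AbsCusp.Prop_2_1_ii_ker
      (KummerUnitsClosureWitness.resHom ℚ_[2]) (KummerUnitsClosureWitness.resHom ℚ_[2])
      (fun c : C₀.Cusp => C₀.Icusp c) :=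
    h M (ULift.up false) (ULift.up true) (ULift.up true) trivial trivial PUnit.unit trivial hcyc
      (isMLF_padic 2) (fun c => c.elim)
  exact not_prop_2_1_ii_ker_junk ℚ_[2] (KummerUnitsClosureWitness.resHom ℚ_[2])
    (fun c : C₀.Cusp => C₀.Icusp c) (fun _ x => x.elim) hP

end AbsCusp

end Literature.AnabelianGeometry.AbsoluteAnabelian

end
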